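import Summits.AnomalousDissipation.AnomalousDissipation.Theorems.SolenoidalFractalHomogenisationLagrangianStepLedgerGrid
import Summits.AnomalousDissipation.AnomalousDissipation.Theorems.SolenoidalFractalHomogenisationLagrangianStepOneLevelSplitGlueL
import Summits.AnomalousDissipation.AnomalousDissipation.Theorems.SolenoidalFractalHomogenisationLagrangianStepOneLevelSplitDefsH
import Summits.AnomalousDissipation.AnomalousDissipation.Theorems.SolenoidalFractalHomogenisationLagrangianStepTrimLevel
import Summits.AnomalousDissipation.AnomalousDissipation.Theorems.SolenoidalFractalHomogenisationLagrangianStepTemplateAsymptotics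
import Literature.Analysis.FluidPDE.PassiveVectorTensorPropagatorEnergy
import HarnessLib

/-!
# K1L_D (stmt-AnomalousDissipation-27980), S23‴ `stub_windowDefectH`: the OPERATOR-LEVEL GLUE
# `windowDefectH_of_windowFacts : (window facts, operator form) → (S23‴ text of record, Kb-fix 67be95a17dc9ee1d)`
# (helper; `--supports … --as helper`; lead-k1l-onelevel-p1 g3)

The S23‴ text (registry v4 `stub_windowDefectH`) is reduced to ONE operator-level statement «window facts» with the SAME prefix (design, (V), (F),
the high-label decay family (H)): regime pins and template constants, one small scale `ηm = Cw ρ^σw` and the explicit super-small slop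
`ε = ρ^σw · (1 − e^(−4π² kbar_m lo)) · refresh (m+1)`, the smallness of the refresh window, and — for every trim level `Lc` below the TrimLevel cap
`ρ^(1/64) N(m+1) cellVisc(m+1)/√c`, every window shape and every pair of propagators — an orthogonal three-way splitting `P ⊕ Q₁ ⊕ Q₂` of `V2`
(abstractly: the label classes `≤ Lc/2`, `(Lc/2, Lg]`, `> Lg`) with `Q₂ x₁ = 0` on band-limited data and the per-window operator facts (Z) (Hi) (Rec)
(…LedgerTransfer) on every grid-aligned window `[j·refresh, s']`, `refresh ≤ s' − j·refresh ≤ 2·refresh`, along the true chain.  (Architecture of record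
p4 g12 L4c §3.2–3.4; (Z) ← W3/W5/W6/(X_G⁺) via `dd_assembly_op`, (Hi) ← (E_G⁺) forward/adjoint, (Rec) ← in-range contraction ⊕ (M♭_G) from (H), reset
deposits `√(ηm 𝔇)`, climbs.)  PROOF of the glue: constants `Cη := 1800 Cw + 6250`, `ση := σw`, `Cτ := 1`, `στ := 1/16`; `Lc` and the export from
`trimLevel_export`; `grid_transfer` along the refresh grid of `t`; the coarse DROP FLOOR `(1 − e^(−4π² kbar_m lo)) ‖x₁‖² ≤ ‖x₁‖² − ‖Um 0 t x₁‖²` for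
EVERY `t ∈ (1/2,1)` (`stub_baseT` + `existsL_tensor` + `IsPropagator.repr` a.e., upgraded to every `t` by the monotonicity `IsPropagator.norm_apply_le_of_le`)
absorbs all super-small terms.  Sorry-free.  NOT a proof of S23‴ (the window facts are the new obligation), of the crux, or of AD; rung F-D1.A0.
Amendment 1: `windowDefectH_of_windowFactsPinned` — facts asked only AT the trim cap `Lc = ⌊ρ^(1/64) N(m+1) ν(m+1)/√c⌋₊` (registry v6 text).
-/

set_option linter.dupNamespace false

noncomputable section

namespace Summit.AnomalousDissipation.AnomalousDissipation.Theorems.SolenoidalFractalHomogenisation.LagrangianStep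

open Literature.Analysis Literature.Analysis.FluidPDE Literature.Analysis.FunctionSpaces
open MeasureTheory Set Filter ContinuousLinearMap
open scoped ENNReal NNReal InnerProductSpace
open Summit.AnomalousDissipation.AnomalousDissipation.Theorems.SolenoidalFractalHomogenisation.RealisedQuasiStaticCellLaw
open Summit.AnomalousDissipation.AnomalousDissipation.Theorems.SolenoidalFractalHomogenisation.LagrangianRenormalisationStep
open OneLevelSplit

/-! ## The coarse drop floor at EVERY time -/

/-- **Coarse drop floor at every time.**  Along an `L`-permissible regular carrier, a propagator family of a coercive constant tensor
(`NearIso 𝔸 lo hi`, `lo > 0`) on `[0,1]` loses at least the fraction `1 − e^(−4π² lo)` of the energy of every admissible datum by every time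
`t ∈ (1/2, 1)`: `stub_baseT` (a.e. in time, on weak solutions) transported to the propagator by `repr` and to every `t` by monotonicity. -/
theorem coarse_drop_floor {k : ℕ} (E : LatticeShear.LagrangianLatticeCarrier k) (hL : E.LPermissible) (hR : E.Regular) (m : ℕ)
    {𝔸 : Torus.Visc4 (Fin 3)} {lo hi : ℝ} (hlo : 0 < lo) (hNI : Torus.NearIso 𝔸 lo hi)
    {Um : ℝ → ℝ → (V2 →L[ℝ] V2)} (hUm : Torus.IsPropagator 1 (E.partialSum m) 𝔸 Um)
    (w₁ : VF) (hw₁ : IsDatum w₁) {t : ℝ} (ht : t ∈ Ioo (1/2 : ℝ) 1) :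
    (1 - Real.exp (-(4 * Real.pi ^ 2 * lo))) * ‖datumLp w₁ hw₁‖ ^ 2 ≤ ‖datumLp w₁ hw₁‖ ^ 2 - ‖Um 0 t (datumLp w₁ hw₁)‖ ^ 2 := by
  obtain ⟨v, hv⟩ := existsL_tensor E hR m hNI hlo w₁ hw₁
  have hw₁2 : MemLp w₁ 2 volume := memLp_two_of_memSobolev_one_complexify hw₁.1
  have hrepv := hUm.repr 0 le_rfl zero_lt_one w₁ hw₁2 hw₁.2.2 v (by simpa only [TSol, sub_zero, zero_add] using hv)
  have hbase := stub_baseT k E hL hR m 𝔸 lo hi hlo hNI w₁ v hw₁ hv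
  -- restrict both a.e. statements to `(1/2, t)` and pick a good time `τ`
  have hsub1 : Ioo (1/2 : ℝ) t ⊆ Ioo 0 (1 - 0) := by rw [sub_zero]; exact Ioo_subset_Ioo (by norm_num) ht.2.le
  have hsub2 : Ioo (1/2 : ℝ) t ⊆ Ioo (1/2 : ℝ) 1 := Ioo_subset_Ioo le_rfl ht.2.le
  have h1 := ae_restrict_of_ae_restrict_of_subset hsub1 hrepv
  have h2 := ae_restrict_of_ae_restrict_of_subset hsub2 hbase
  have h3 : ∀ᵐ τ ∂(volume.restrict (Ioo (1/2 : ℝ) t)), τ ∈ Ioo (1/2 : ℝ) t := ae_restrict_mem measurableSet_Ioo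
  have hne : volume.restrict (Ioo (1/2 : ℝ) t) ≠ 0 := by
    rw [Ne, Measure.restrict_eq_zero, Real.volume_Ioo, ENNReal.ofReal_eq_zero, not_le]
    linarith [ht.1]
  haveI : (ae (volume.restrict (Ioo (1/2 : ℝ) t))).NeBot := ae_neBot.2 hne
  obtain ⟨τ, ⟨hτm, hτe⟩, hτb, hτ⟩ := (h1.and (h2.and h3)).exists
  rw [zero_add] at hτe
  -- at `τ`: `‖Um 0 τ x‖² = ∫‖v τ‖²` and the floor
  have hE0 : Torus.vectorL2Sq w₁ = ‖datumLp w₁ hw₁‖ ^ 2 := (norm_datumLp_sq w₁ hw₁).symm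
  have hEv : ∫ a, ‖v τ a‖ ^ 2 = ‖Um 0 τ (datumLp w₁ hw₁)‖ ^ 2 := by
    rw [← norm_toLp_sq hτm, hτe]; rfl
  have hfl : (1 - Real.exp (-(4 * Real.pi ^ 2 * lo))) * ‖datumLp w₁ hw₁‖ ^ 2
      ≤ ‖datumLp w₁ hw₁‖ ^ 2 - ‖Um 0 τ (datumLp w₁ hw₁)‖ ^ 2 := by
    have h := hτb; simp only [drop] at h; rw [hEv, hE0] at h; exact h
  -- monotonicity `‖Um 0 t x‖ ≤ ‖Um 0 τ x‖`
  have hmono : ‖Um 0 t (datumLp w₁ hw₁)‖ ≤ ‖Um 0 τ (datumLp w₁ hw₁)‖ :=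
    hUm.norm_apply_le_of_le le_rfl (by linarith [hτ.1]) hτ.2.le ht.2.le (datumLp w₁ hw₁)
  have hmono2 : ‖Um 0 t (datumLp w₁ hw₁)‖ ^ 2 ≤ ‖Um 0 τ (datumLp w₁ hw₁)‖ ^ 2 := pow_le_pow_left₀ (norm_nonneg _) hmono 2
  linarith

/-! ## The glue -/

set_option maxHeartbeats 800000 in
/-- **S23‴ from the window facts.**  See the module docstring.  The hypothesis is the operator-level «window facts» text (future stub
`stub_windowFactsH`); the conclusion is the registered S23‴ text `stub_windowDefectH` byte-for-byte. -/
theorem windowDefectH_of_windowFacts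
    (hWF : ∀ k (W : Literature.Analysis.FluidPDE.LatticeShear.LatticeWord k) (M : ℝ) (hM : 0 < M) (c : ℝ), 0 < c →
    ∀ (Φ : ℝ → Torus.Visc4 (Fin 3) → Torus.Visc4 (Fin 3)) (lo hi Λ β σ C ν₀ K Cf νf Kf : ℝ),
      0 < lo → lo ≤ 1 → 1 ≤ hi → 1 < Λ → 0 ≤ β →
      0 < σ → 0 ≤ C → 0 < ν₀ → 0 < K → SlowVectorClauseF W M hM c Φ lo hi Λ β σ C ν₀ K →
      0 ≤ Cf → 0 < νf → 0 < Kf → CellEnergyClausesW W M hM c lo hi Λ β Cf νf Kf →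
      (∀ Kb : ℝ, 1 ≤ Kb → ∃ CK : ℝ, 1 ≤ CK ∧ ∃ cK > (0:ℝ), ∃ νh > (0:ℝ), HighLabelDecayW W M hM lo hi Λ β νh Kb CK cK) →
      ∃ ν₁ > (0:ℝ), ∃ K₁ > (0:ℝ), ∃ Λ₀ : ℕ, ∃ θ₀ > (0:ℝ), ∃ Cw > (0:ℝ), ∃ σw > (0:ℝ),
        ∀ E : Literature.Analysis.FluidPDE.LatticeShear.LagrangianLatticeCarrier k, E.design = W.stretch M hM → E.gain = c → E.nu0 ≤ ν₁ → K₁ ≤ E.K →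
          E.LPermissible → E.Regular → (∀ m, Λ₀ * E.N m ≤ E.N (m + 1)) → (∀ m, E.N m ^ 2 ≤ E.N (m + 1)) →
          (∀ m, E.cellVisc (m + 1) * ((E.N (m + 1) : ℝ) / E.N m) ^ (1 / 4 : ℝ) ≤ 1) →
          (∀ m, E.K * ((E.N (m + 1) : ℝ) / E.N m) ^ (1 / 4 : ℝ) ≤ ((E.N (m + 1) : ℝ) / E.N m) * E.cellVisc (m + 1)) →
          (∀ m, E.θ (m + 1) * ((E.N (m + 1) : ℝ) / E.N m) ^ (1 / 16 : ℝ) ≤ θ₀) →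
          (∀ m, ((E.N (m + 1) : ℝ) / E.N m) ^ (1 / 16 : ℝ) * E.physPeriod (m + 1) ≤ E.refresh (m + 1)) →
        ∃ mstar : ℕ, ∀ m, mstar ≤ m →
          E.refresh (m + 1) ≤ 1 / 4 ∧
          ∀ Lc : ℕ, (Lc : ℝ) ≤ ((E.N m : ℝ) / E.N (m + 1)) ^ (1 / 64 : ℝ) * (E.N (m + 1) * E.cellVisc (m + 1)) / Real.sqrt c →
          ∀ S : Torus.Visc4 (Fin 3), Torus.OddSmall S β → Torus.NearIso S lo hi →
            Torus.OddSmall (Φ (E.cellVisc (m + 1)) S) β → Torus.NearIso (Φ (E.cellVisc (m + 1)) S) lo hi →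
          ∀ Um Um1 : ℝ → ℝ → (V2 →L[ℝ] V2),
            Torus.IsPropagator 1 (E.partialSum m) (E.kbar m • renormStep (Φ (E.cellVisc (m + 1))) (E.gain / E.cellVisc (m + 1) ^ 2) S) Um →
            Torus.IsPropagator 1 (E.partialSum (m + 1)) (E.kbar (m + 1) • S) Um1 →
          ∀ ηm ε : ℝ, ηm = Cw * ((E.N m : ℝ) / E.N (m + 1)) ^ σw →
            ε = ((E.N m : ℝ) / E.N (m + 1)) ^ σw * (1 - Real.exp (-(4 * Real.pi ^ 2 * (E.kbar m * lo)))) * E.refresh (m + 1) →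
          ∃ P Q₁ Q₂ : V2 →L[ℝ] V2,
            (∀ y : V2, P y + Q₁ y + Q₂ y = y) ∧ (∀ y : V2, ‖y‖ ^ 2 = ‖P y‖ ^ 2 + ‖Q₁ y‖ ^ 2 + ‖Q₂ y‖ ^ 2) ∧
            (∀ y y' : V2, ⟪P y, Q₁ y' + Q₂ y'⟫_ℝ = 0) ∧
          ∀ (w₁ : VF) (hw₁ : IsDatum w₁), Torus.fourierTruncate Lc w₁ = w₁ →
            Q₂ (datumLp w₁ hw₁) = 0 ∧
            ∀ (j : ℕ) (s' : ℝ), (j : ℝ) * E.refresh (m + 1) + E.refresh (m + 1) ≤ s' →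
              s' ≤ (j : ℝ) * E.refresh (m + 1) + 2 * E.refresh (m + 1) → s' ≤ 1 →
            (∀ y : V2, |⟪y, P (Um1 ((j : ℝ) * E.refresh (m + 1)) s' (Um1 0 ((j : ℝ) * E.refresh (m + 1)) (datumLp w₁ hw₁)) - Um ((j : ℝ) * E.refresh (m + 1)) s' (Um1 0 ((j : ℝ) * E.refresh (m + 1)) (datumLp w₁ hw₁)))⟫_ℝ| ≤
                ηm * Real.sqrt (‖Um1 0 ((j : ℝ) * E.refresh (m + 1)) (datumLp w₁ hw₁)‖ ^ 2 - ‖Um ((j : ℝ) * E.refresh (m + 1)) s' (Um1 0 ((j : ℝ) * E.refresh (m + 1)) (datumLp w₁ hw₁))‖ ^ 2) * Real.sqrt (‖y‖ ^ 2 - ‖adjoint (Um ((j : ℝ) * E.refresh (m + 1)) s') y‖ ^ 2) + ε * ‖datumLp w₁ hw₁‖ * ‖y‖) ∧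
            (∀ y : V2, ‖Um ((j : ℝ) * E.refresh (m + 1)) s' (Q₁ y + Q₂ y)‖ ≤ ε * ‖y‖ ∧ ‖Q₁ (Um ((j : ℝ) * E.refresh (m + 1)) s' y) + Q₂ (Um ((j : ℝ) * E.refresh (m + 1)) s' y)‖ ≤ ε * ‖y‖ ∧
                ‖adjoint (Um ((j : ℝ) * E.refresh (m + 1)) s') (Q₁ y + Q₂ y)‖ ≤ ε * ‖y‖) ∧
            ‖Q₁ (Um1 ((j : ℝ) * E.refresh (m + 1)) s' (P (Um1 0 ((j : ℝ) * E.refresh (m + 1)) (datumLp w₁ hw₁))))‖ ≤ Real.sqrt (ηm * (‖Um1 0 ((j : ℝ) * E.refresh (m + 1)) (datumLp w₁ hw₁)‖ ^ 2 - ‖Um ((j : ℝ) * E.refresh (m + 1)) s' (Um1 0 ((j : ℝ) * E.refresh (m + 1)) (datumLp w₁ hw₁))‖ ^ 2)) + ε * ‖datumLp w₁ hw₁‖ ∧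
            ‖Q₂ (Um1 ((j : ℝ) * E.refresh (m + 1)) s' (P (Um1 0 ((j : ℝ) * E.refresh (m + 1)) (datumLp w₁ hw₁))))‖ ≤ Real.sqrt (ηm * (‖Um1 0 ((j : ℝ) * E.refresh (m + 1)) (datumLp w₁ hw₁)‖ ^ 2 - ‖Um ((j : ℝ) * E.refresh (m + 1)) s' (Um1 0 ((j : ℝ) * E.refresh (m + 1)) (datumLp w₁ hw₁))‖ ^ 2)) + ε * ‖datumLp w₁ hw₁‖ ∧
            ‖Q₁ (Um1 ((j : ℝ) * E.refresh (m + 1)) s' (Q₁ (Um1 0 ((j : ℝ) * E.refresh (m + 1)) (datumLp w₁ hw₁))))‖ ≤ ηm * ‖Q₁ (Um1 0 ((j : ℝ) * E.refresh (m + 1)) (datumLp w₁ hw₁))‖ + ε * ‖datumLp w₁ hw₁‖ ∧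
            ‖Q₂ (Um1 ((j : ℝ) * E.refresh (m + 1)) s' (Q₁ (Um1 0 ((j : ℝ) * E.refresh (m + 1)) (datumLp w₁ hw₁))))‖ ≤ ηm * ‖Q₁ (Um1 0 ((j : ℝ) * E.refresh (m + 1)) (datumLp w₁ hw₁))‖ + ε * ‖datumLp w₁ hw₁‖ ∧
            ‖Q₁ (Um1 ((j : ℝ) * E.refresh (m + 1)) s' (Q₂ (Um1 0 ((j : ℝ) * E.refresh (m + 1)) (datumLp w₁ hw₁))))‖ ≤ ηm * ‖Q₂ (Um1 0 ((j : ℝ) * E.refresh (m + 1)) (datumLp w₁ hw₁))‖ + ε * ‖datumLp w₁ hw₁‖ ∧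
            ‖Q₂ (Um1 ((j : ℝ) * E.refresh (m + 1)) s' (Q₂ (Um1 0 ((j : ℝ) * E.refresh (m + 1)) (datumLp w₁ hw₁))))‖ ≤ 1 / 2 * ‖Q₂ (Um1 0 ((j : ℝ) * E.refresh (m + 1)) (datumLp w₁ hw₁))‖ + ε * ‖datumLp w₁ hw₁‖) :
    ∀ k (W : Literature.Analysis.FluidPDE.LatticeShear.LatticeWord k) (M : ℝ) (hM : 0 < M) (c : ℝ), 0 < c →
    ∀ (Φ : ℝ → Torus.Visc4 (Fin 3) → Torus.Visc4 (Fin 3)) (lo hi Λ β σ C ν₀ K Cf νf Kf : ℝ),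
      0 < lo → lo ≤ 1 → 1 ≤ hi → 1 < Λ → 0 ≤ β →
      0 < σ → 0 ≤ C → 0 < ν₀ → 0 < K → SlowVectorClauseF W M hM c Φ lo hi Λ β σ C ν₀ K →
      0 ≤ Cf → 0 < νf → 0 < Kf → CellEnergyClausesW W M hM c lo hi Λ β Cf νf Kf →
      (∀ Kb : ℝ, 1 ≤ Kb → ∃ CK : ℝ, 1 ≤ CK ∧ ∃ cK > (0:ℝ), ∃ νh > (0:ℝ), HighLabelDecayW W M hM lo hi Λ β νh Kb CK cK) →
      ∃ ν₁ > (0:ℝ), ∃ K₁ > (0:ℝ), ∃ Λ₀ : ℕ, ∃ θ₀ > (0:ℝ), ∃ Cη > (0:ℝ), ∃ ση > (0:ℝ), ∃ Cτ > (0:ℝ), ∃ στ > (0:ℝ),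
        ∀ E : Literature.Analysis.FluidPDE.LatticeShear.LagrangianLatticeCarrier k, E.design = W.stretch M hM → E.gain = c → E.nu0 ≤ ν₁ → K₁ ≤ E.K →
          E.LPermissible → E.Regular → (∀ m, Λ₀ * E.N m ≤ E.N (m + 1)) → (∀ m, E.N m ^ 2 ≤ E.N (m + 1)) →
          (∀ m, E.cellVisc (m + 1) * ((E.N (m + 1) : ℝ) / E.N m) ^ (1 / 4 : ℝ) ≤ 1) →
          (∀ m, E.K * ((E.N (m + 1) : ℝ) / E.N m) ^ (1 / 4 : ℝ) ≤ ((E.N (m + 1) : ℝ) / E.N m) * E.cellVisc (m + 1)) →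
          (∀ m, E.θ (m + 1) * ((E.N (m + 1) : ℝ) / E.N m) ^ (1 / 16 : ℝ) ≤ θ₀) →
          (∀ m, ((E.N (m + 1) : ℝ) / E.N m) ^ (1 / 16 : ℝ) * E.physPeriod (m + 1) ≤ E.refresh (m + 1)) →
        ∀ R : ℝ≥0, ∃ mstar : ℕ, ∀ m, mstar ≤ m →
          ∃ Lc : ℕ,
          (R : ℝ) ≤ Cτ * ((E.N m : ℝ) / E.N (m + 1)) ^ στ * (Lc : ℝ) ^ 2 * (1 - Real.exp (-(4 * Real.pi ^ 2 * (E.kbar m * lo)))) ∧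
          Cη * ((E.N m : ℝ) / E.N (m + 1)) ^ ση ≤ 1 / 8 ∧
          ∀ S : Torus.Visc4 (Fin 3), Torus.OddSmall S β → Torus.NearIso S lo hi →
            Torus.OddSmall (Φ (E.cellVisc (m + 1)) S) β → Torus.NearIso (Φ (E.cellVisc (m + 1)) S) lo hi →
          ∀ (w₁ : VF) (hw₁ : IsDatum w₁), InClass R w₁ → Torus.fourierTruncate Lc w₁ = w₁ →
          ∀ Um Um1 : ℝ → ℝ → (V2 →L[ℝ] V2),
            Torus.IsPropagator 1 (E.partialSum m) (E.kbar m • renormStep (Φ (E.cellVisc (m + 1))) (E.gain / E.cellVisc (m + 1) ^ 2) S) Um →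
            Torus.IsPropagator 1 (E.partialSum (m + 1)) (E.kbar (m + 1) • S) Um1 →
          ∀ t ∈ Ioo (1/2 : ℝ) 1,
            ‖Um1 0 t (datumLp w₁ hw₁)‖ ^ 2
              ≤ ‖Um 0 t (datumLp w₁ hw₁)‖ ^ 2
                + Cη * ((E.N m : ℝ) / E.N (m + 1)) ^ ση * (‖datumLp w₁ hw₁‖ ^ 2 - ‖Um 0 t (datumLp w₁ hw₁)‖ ^ 2) := by
  intro k W M hM c hc Φ lo hi Λ β σ C ν₀ K Cf νf Kf hlo hlo1 hhi hΛ hβ hσ hC hν₀ hK hV hCf hνf hKf hF hH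
  obtain ⟨ν₁, hν₁, K₁, hK₁, Λ₀, θ₀, hθ₀, Cw, hCw, σw, hσw, hfacts⟩ :=
    hWF k W M hM c hc Φ lo hi Λ β σ C ν₀ K Cf νf Kf hlo hlo1 hhi hΛ hβ hσ hC hν₀ hK hV hCf hνf hKf hF hH
  refine ⟨ν₁, hν₁, K₁, hK₁, Λ₀, θ₀, hθ₀, 1800 * Cw + 6250, by positivity, σw, hσw, 1, one_pos, 1 / 16, by norm_num, ?_⟩
  intro E hdes hgain hnu0 hKE hLP hReg hT1 hN2 hT2 hT3 hT4 hT5 R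
  have hP : E.toFractalCarrierData.Permissible := hLP.1
  -- three eventual requirements on `m`
  obtain ⟨m₁, hm₁⟩ := trimLevel_export E hdes hc hgain hLP hθ₀ hT4 hT5 hT3 hN2 hlo (R : ℝ)
  obtain ⟨m₂, hm₂⟩ := hfacts E hdes hgain hnu0 hKE hLP hReg hT1 hN2 hT2 hT3 hT4 hT5
  obtain ⟨m₃, hm₃⟩ := exists_forall_mul_rho_rpow_le E.toFractalCarrierData hP hN2 (1800 * Cw + 6250) hσw (by norm_num : (0:ℝ) < 1 / 8)
  refine ⟨max m₁ (max m₂ m₃), fun m hm => ?_⟩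
  have hm1 : m₁ ≤ m := le_trans (le_max_left _ _) hm
  have hm2 : m₂ ≤ m := le_trans ((le_max_left _ _).trans (le_max_right _ _)) hm
  have hm3 : m₃ ≤ m := le_trans ((le_max_right _ _).trans (le_max_right _ _)) hm
  obtain ⟨Lc, hLc, hexport⟩ := hm₁ m hm1
  have hsmall : (1800 * Cw + 6250) * ((E.N m : ℝ) / E.N (m + 1)) ^ σw ≤ 1 / 8 := hm₃ m hm3
  obtain ⟨hr4, hfm⟩ := hm₂ m hm2
  refine ⟨Lc, by simpa using hexport, hsmall, ?_⟩
  intro S hS₁ hS₂ hS₃ hS₄ w₁ hw₁ _hRw hband Um Um1 hUm hUm1 t ht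
  -- notation
  set ρ : ℝ := (E.N m : ℝ) / E.N (m + 1) with hρ_def
  set r : ℝ := E.refresh (m + 1) with hr_def
  set fl : ℝ := 1 - Real.exp (-(4 * Real.pi ^ 2 * (E.kbar m * lo))) with hfl_def
  set ηm : ℝ := Cw * ρ ^ σw with hηm_def
  set ε : ℝ := ρ ^ σw * fl * r with hε_def
  set x : V2 := datumLp w₁ hw₁ with hx_def
  have hρ0 : 0 ≤ ρ := by rw [hρ_def]; have := E.N_pos m; have := E.N_pos (m + 1); positivity
  have hρσ : 0 ≤ ρ ^ σw := Real.rpow_nonneg hρ0 _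
  have hr : 0 < r := E.refresh_pos (m + 1)
  have hkl : 0 < E.kbar m * lo := mul_pos (E.kbar_pos m) hlo
  have hfl0 : 0 ≤ fl := by
    rw [hfl_def, sub_nonneg, Real.exp_le_one_iff]; have : 0 < 4 * Real.pi ^ 2 * (E.kbar m * lo) := by positivity
    linarith
  have hfl1 : fl ≤ 1 := by rw [hfl_def]; linarith [Real.exp_pos (-(4 * Real.pi ^ 2 * (E.kbar m * lo)))]
  have hηm0 : 0 ≤ ηm := by rw [hηm_def]; positivity
  have hηm : ηm ≤ 1 / 3600 := by rw [hηm_def]; nlinarith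
  have hρσ1 : ρ ^ σw ≤ 1 / 6250 := by nlinarith
  have hε0 : 0 ≤ ε := by rw [hε_def]; positivity
  have hε1 : ε ≤ 1 := by
    rw [hε_def]
    calc ρ ^ σw * fl * r ≤ 1 / 6250 * 1 * (1 / 4) := by
          apply mul_le_mul (mul_le_mul hρσ1 hfl1 hfl0 (by norm_num)) hr4 hr.le (by norm_num)
      _ ≤ 1 := by norm_num
  -- the facts at this `m`, `Lc`, `S`, propagators
  obtain ⟨P, Q₁, Q₂, hPQ, hpyth, horth, hfw⟩ := hfm Lc hLc S hS₁ hS₂ hS₃ hS₄ Um Um1 hUm hUm1 ηm ε rfl rfl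
  obtain ⟨hQx, hwin⟩ := hfw w₁ hw₁ hband
  -- the transfer ledger along the grid of `t`
  have hx_div : Torus.IsWeaklyDivFree ((x : V2) : VF) := isWeaklyDivFree_datumLp w₁ hw₁
  have key := grid_transfer Um Um1 P Q₁ Q₂ x hr (by linarith [ht.1]) ht.2.le
    hUm.norm_le hUm1.norm_le
    (fun s s' s'' y hs hss' hs's'' hs''1 => hUm.comp s s' s'' hs hss' hs's'' hs''1 y)
    (fun s s' s'' y hs hss' hs's'' hs''1 => hUm1.comp s s' s'' hs hss' hs's'' hs''1 y)
    (hUm.self_of_divFree 0 le_rfl zero_le_one x hx_div) (hUm1.self_of_divFree 0 le_rfl zero_le_one x hx_div)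
    hPQ hpyth horth hQx hηm0 hηm hε0 hε1
    (fun j s' h1 h2 h3 => hwin j s' h1 h2 (h3.trans ht.2.le))
  -- the coarse drop floor
  have hgain0 : 0 ≤ E.gain := hgain ▸ hc.le
  have h𝔸v : Torus.NearIso (E.kbar m • renormStep (Φ (E.cellVisc (m + 1))) (E.gain / E.cellVisc (m + 1) ^ 2) S)
      (E.kbar m * lo) (E.kbar m * hi) :=
    (nearIso_renormStep (div_nonneg hgain0 (sq_nonneg _)) hS₂ hS₄).smul (E.kbar_pos m).le
  have hfloor : fl * ‖x‖ ^ 2 ≤ ‖x‖ ^ 2 - ‖Um 0 t x‖ ^ 2 := coarse_drop_floor E hLP hReg m hkl h𝔸v hUm w₁ hw₁ ht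
  -- arithmetic
  have hx0 : 0 ≤ ‖x‖ ^ 2 := sq_nonneg _
  have hdrop0 : 0 ≤ ‖x‖ ^ 2 - ‖Um 0 t x‖ ^ 2 := le_trans (mul_nonneg hfl0 hx0) hfloor
  have ht1 : t ≤ 1 := ht.2.le
  have hjunk : 5000 * (t / r + 1) * ε * ‖x‖ ^ 2 ≤ 6250 * ρ ^ σw * (‖x‖ ^ 2 - ‖Um 0 t x‖ ^ 2) := by
    have e1 : (t / r + 1) * ε = ρ ^ σw * fl * (t + r) := by
      rw [hε_def]; field_simp
    have h2 : 5000 * (t / r + 1) * ε * ‖x‖ ^ 2 = 5000 * (ρ ^ σw * (t + r)) * (fl * ‖x‖ ^ 2) := by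
      rw [show 5000 * (t / r + 1) * ε * ‖x‖ ^ 2 = 5000 * ((t / r + 1) * ε) * ‖x‖ ^ 2 by ring, e1]; ring
    rw [h2]
    have h3 : t + r ≤ 5 / 4 := by linarith
    have h4 : 5000 * (ρ ^ σw * (t + r)) ≤ 6250 * ρ ^ σw := by nlinarith
    calc 5000 * (ρ ^ σw * (t + r)) * (fl * ‖x‖ ^ 2) ≤ 6250 * ρ ^ σw * (fl * ‖x‖ ^ 2) :=
          mul_le_mul_of_nonneg_right h4 (mul_nonneg hfl0 hx0)
      _ ≤ 6250 * ρ ^ σw * (‖x‖ ^ 2 - ‖Um 0 t x‖ ^ 2) := mul_le_mul_of_nonneg_left hfloor (by positivity)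
  have hmain : 1800 * ηm * (‖x‖ ^ 2 - ‖Um 0 t x‖ ^ 2) + 6250 * ρ ^ σw * (‖x‖ ^ 2 - ‖Um 0 t x‖ ^ 2)
      = (1800 * Cw + 6250) * ρ ^ σw * (‖x‖ ^ 2 - ‖Um 0 t x‖ ^ 2) := by rw [hηm_def]; ring
  linarith [key, hjunk, hmain]

set_option maxHeartbeats 800000 in
/-- **S23‴ from the window facts, TRIM LEVEL PINNED** at `Lc = ⌊ρ^(1/64) N(m+1) cellVisc(m+1)/√c⌋₊` (registry v6 text of `stub_windowFactsH`; for
small `Lc` the class `> Lc/2` is not killed by the coarse map, so the `∀ Lc ≤ cap` form over-asks; the TrimLevel export is monotone in `Lc`). -/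
theorem windowDefectH_of_windowFactsPinned
    (hWF : ∀ k (W : Literature.Analysis.FluidPDE.LatticeShear.LatticeWord k) (M : ℝ) (hM : 0 < M) (c : ℝ), 0 < c →
    ∀ (Φ : ℝ → Torus.Visc4 (Fin 3) → Torus.Visc4 (Fin 3)) (lo hi Λ β σ C ν₀ K Cf νf Kf : ℝ),
      0 < lo → lo ≤ 1 → 1 ≤ hi → 1 < Λ → 0 ≤ β →
      0 < σ → 0 ≤ C → 0 < ν₀ → 0 < K → SlowVectorClauseF W M hM c Φ lo hi Λ β σ C ν₀ K →
      0 ≤ Cf → 0 < νf → 0 < Kf → CellEnergyClausesW W M hM c lo hi Λ β Cf νf Kf →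
      (∀ Kb : ℝ, 1 ≤ Kb → ∃ CK : ℝ, 1 ≤ CK ∧ ∃ cK > (0:ℝ), ∃ νh > (0:ℝ), HighLabelDecayW W M hM lo hi Λ β νh Kb CK cK) →
      ∃ ν₁ > (0:ℝ), ∃ K₁ > (0:ℝ), ∃ Λ₀ : ℕ, ∃ θ₀ > (0:ℝ), ∃ Cw > (0:ℝ), ∃ σw > (0:ℝ),
        ∀ E : Literature.Analysis.FluidPDE.LatticeShear.LagrangianLatticeCarrier k, E.design = W.stretch M hM → E.gain = c → E.nu0 ≤ ν₁ → K₁ ≤ E.K →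
          E.LPermissible → E.Regular → (∀ m, Λ₀ * E.N m ≤ E.N (m + 1)) → (∀ m, E.N m ^ 2 ≤ E.N (m + 1)) →
          (∀ m, E.cellVisc (m + 1) * ((E.N (m + 1) : ℝ) / E.N m) ^ (1 / 4 : ℝ) ≤ 1) →
          (∀ m, E.K * ((E.N (m + 1) : ℝ) / E.N m) ^ (1 / 4 : ℝ) ≤ ((E.N (m + 1) : ℝ) / E.N m) * E.cellVisc (m + 1)) →
          (∀ m, E.θ (m + 1) * ((E.N (m + 1) : ℝ) / E.N m) ^ (1 / 16 : ℝ) ≤ θ₀) →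
          (∀ m, ((E.N (m + 1) : ℝ) / E.N m) ^ (1 / 16 : ℝ) * E.physPeriod (m + 1) ≤ E.refresh (m + 1)) →
        ∃ mstar : ℕ, ∀ m, mstar ≤ m →
          E.refresh (m + 1) ≤ 1 / 4 ∧
          ∀ Lc : ℕ, Lc = ⌊((E.N m : ℝ) / E.N (m + 1)) ^ (1 / 64 : ℝ) * (E.N (m + 1) * E.cellVisc (m + 1)) / Real.sqrt c⌋₊ →
          ∀ S : Torus.Visc4 (Fin 3), Torus.OddSmall S β → Torus.NearIso S lo hi →
            Torus.OddSmall (Φ (E.cellVisc (m + 1)) S) β → Torus.NearIso (Φ (E.cellVisc (m + 1)) S) lo hi →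
          ∀ Um Um1 : ℝ → ℝ → (V2 →L[ℝ] V2),
            Torus.IsPropagator 1 (E.partialSum m) (E.kbar m • renormStep (Φ (E.cellVisc (m + 1))) (E.gain / E.cellVisc (m + 1) ^ 2) S) Um →
            Torus.IsPropagator 1 (E.partialSum (m + 1)) (E.kbar (m + 1) • S) Um1 →
          ∀ ηm ε : ℝ, ηm = Cw * ((E.N m : ℝ) / E.N (m + 1)) ^ σw →
            ε = ((E.N m : ℝ) / E.N (m + 1)) ^ σw * (1 - Real.exp (-(4 * Real.pi ^ 2 * (E.kbar m * lo)))) * E.refresh (m + 1) →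
          ∃ P Q₁ Q₂ : V2 →L[ℝ] V2,
            (∀ y : V2, P y + Q₁ y + Q₂ y = y) ∧ (∀ y : V2, ‖y‖ ^ 2 = ‖P y‖ ^ 2 + ‖Q₁ y‖ ^ 2 + ‖Q₂ y‖ ^ 2) ∧
            (∀ y y' : V2, ⟪P y, Q₁ y' + Q₂ y'⟫_ℝ = 0) ∧
          ∀ (w₁ : VF) (hw₁ : IsDatum w₁), Torus.fourierTruncate Lc w₁ = w₁ →
            Q₂ (datumLp w₁ hw₁) = 0 ∧
            ∀ (j : ℕ) (s' : ℝ), (j : ℝ) * E.refresh (m + 1) + E.refresh (m + 1) ≤ s' →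
              s' ≤ (j : ℝ) * E.refresh (m + 1) + 2 * E.refresh (m + 1) → s' ≤ 1 →
            (∀ y : V2, |⟪y, P (Um1 ((j : ℝ) * E.refresh (m + 1)) s' (Um1 0 ((j : ℝ) * E.refresh (m + 1)) (datumLp w₁ hw₁)) - Um ((j : ℝ) * E.refresh (m + 1)) s' (Um1 0 ((j : ℝ) * E.refresh (m + 1)) (datumLp w₁ hw₁)))⟫_ℝ| ≤
                ηm * Real.sqrt (‖Um1 0 ((j : ℝ) * E.refresh (m + 1)) (datumLp w₁ hw₁)‖ ^ 2 - ‖Um ((j : ℝ) * E.refresh (m + 1)) s' (Um1 0 ((j : ℝ) * E.refresh (m + 1)) (datumLp w₁ hw₁))‖ ^ 2) * Real.sqrt (‖y‖ ^ 2 - ‖adjoint (Um ((j : ℝ) * E.refresh (m + 1)) s') y‖ ^ 2) + ε * ‖datumLp w₁ hw₁‖ * ‖y‖) ∧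
            (∀ y : V2, ‖Um ((j : ℝ) * E.refresh (m + 1)) s' (Q₁ y + Q₂ y)‖ ≤ ε * ‖y‖ ∧ ‖Q₁ (Um ((j : ℝ) * E.refresh (m + 1)) s' y) + Q₂ (Um ((j : ℝ) * E.refresh (m + 1)) s' y)‖ ≤ ε * ‖y‖ ∧
                ‖adjoint (Um ((j : ℝ) * E.refresh (m + 1)) s') (Q₁ y + Q₂ y)‖ ≤ ε * ‖y‖) ∧
            ‖Q₁ (Um1 ((j : ℝ) * E.refresh (m + 1)) s' (P (Um1 0 ((j : ℝ) * E.refresh (m + 1)) (datumLp w₁ hw₁))))‖ ≤ Real.sqrt (ηm * (‖Um1 0 ((j : ℝ) * E.refresh (m + 1)) (datumLp w₁ hw₁)‖ ^ 2 - ‖Um ((j : ℝ) * E.refresh (m + 1)) s' (Um1 0 ((j : ℝ) * E.refresh (m + 1)) (datumLp w₁ hw₁))‖ ^ 2)) + ε * ‖datumLp w₁ hw₁‖ ∧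
            ‖Q₂ (Um1 ((j : ℝ) * E.refresh (m + 1)) s' (P (Um1 0 ((j : ℝ) * E.refresh (m + 1)) (datumLp w₁ hw₁))))‖ ≤ Real.sqrt (ηm * (‖Um1 0 ((j : ℝ) * E.refresh (m + 1)) (datumLp w₁ hw₁)‖ ^ 2 - ‖Um ((j : ℝ) * E.refresh (m + 1)) s' (Um1 0 ((j : ℝ) * E.refresh (m + 1)) (datumLp w₁ hw₁))‖ ^ 2)) + ε * ‖datumLp w₁ hw₁‖ ∧
            ‖Q₁ (Um1 ((j : ℝ) * E.refresh (m + 1)) s' (Q₁ (Um1 0 ((j : ℝ) * E.refresh (m + 1)) (datumLp w₁ hw₁))))‖ ≤ ηm * ‖Q₁ (Um1 0 ((j : ℝ) * E.refresh (m + 1)) (datumLp w₁ hw₁))‖ + ε * ‖datumLp w₁ hw₁‖ ∧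
            ‖Q₂ (Um1 ((j : ℝ) * E.refresh (m + 1)) s' (Q₁ (Um1 0 ((j : ℝ) * E.refresh (m + 1)) (datumLp w₁ hw₁))))‖ ≤ ηm * ‖Q₁ (Um1 0 ((j : ℝ) * E.refresh (m + 1)) (datumLp w₁ hw₁))‖ + ε * ‖datumLp w₁ hw₁‖ ∧
            ‖Q₁ (Um1 ((j : ℝ) * E.refresh (m + 1)) s' (Q₂ (Um1 0 ((j : ℝ) * E.refresh (m + 1)) (datumLp w₁ hw₁))))‖ ≤ ηm * ‖Q₂ (Um1 0 ((j : ℝ) * E.refresh (m + 1)) (datumLp w₁ hw₁))‖ + ε * ‖datumLp w₁ hw₁‖ ∧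
            ‖Q₂ (Um1 ((j : ℝ) * E.refresh (m + 1)) s' (Q₂ (Um1 0 ((j : ℝ) * E.refresh (m + 1)) (datumLp w₁ hw₁))))‖ ≤ 1 / 2 * ‖Q₂ (Um1 0 ((j : ℝ) * E.refresh (m + 1)) (datumLp w₁ hw₁))‖ + ε * ‖datumLp w₁ hw₁‖) :
    ∀ k (W : Literature.Analysis.FluidPDE.LatticeShear.LatticeWord k) (M : ℝ) (hM : 0 < M) (c : ℝ), 0 < c →
    ∀ (Φ : ℝ → Torus.Visc4 (Fin 3) → Torus.Visc4 (Fin 3)) (lo hi Λ β σ C ν₀ K Cf νf Kf : ℝ),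
      0 < lo → lo ≤ 1 → 1 ≤ hi → 1 < Λ → 0 ≤ β →
      0 < σ → 0 ≤ C → 0 < ν₀ → 0 < K → SlowVectorClauseF W M hM c Φ lo hi Λ β σ C ν₀ K →
      0 ≤ Cf → 0 < νf → 0 < Kf → CellEnergyClausesW W M hM c lo hi Λ β Cf νf Kf →
      (∀ Kb : ℝ, 1 ≤ Kb → ∃ CK : ℝ, 1 ≤ CK ∧ ∃ cK > (0:ℝ), ∃ νh > (0:ℝ), HighLabelDecayW W M hM lo hi Λ β νh Kb CK cK) →
      ∃ ν₁ > (0:ℝ), ∃ K₁ > (0:ℝ), ∃ Λ₀ : ℕ, ∃ θ₀ > (0:ℝ), ∃ Cη > (0:ℝ), ∃ ση > (0:ℝ), ∃ Cτ > (0:ℝ), ∃ στ > (0:ℝ),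
        ∀ E : Literature.Analysis.FluidPDE.LatticeShear.LagrangianLatticeCarrier k, E.design = W.stretch M hM → E.gain = c → E.nu0 ≤ ν₁ → K₁ ≤ E.K →
          E.LPermissible → E.Regular → (∀ m, Λ₀ * E.N m ≤ E.N (m + 1)) → (∀ m, E.N m ^ 2 ≤ E.N (m + 1)) →
          (∀ m, E.cellVisc (m + 1) * ((E.N (m + 1) : ℝ) / E.N m) ^ (1 / 4 : ℝ) ≤ 1) →
          (∀ m, E.K * ((E.N (m + 1) : ℝ) / E.N m) ^ (1 / 4 : ℝ) ≤ ((E.N (m + 1) : ℝ) / E.N m) * E.cellVisc (m + 1)) →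
          (∀ m, E.θ (m + 1) * ((E.N (m + 1) : ℝ) / E.N m) ^ (1 / 16 : ℝ) ≤ θ₀) →
          (∀ m, ((E.N (m + 1) : ℝ) / E.N m) ^ (1 / 16 : ℝ) * E.physPeriod (m + 1) ≤ E.refresh (m + 1)) →
        ∀ R : ℝ≥0, ∃ mstar : ℕ, ∀ m, mstar ≤ m →
          ∃ Lc : ℕ,
          (R : ℝ) ≤ Cτ * ((E.N m : ℝ) / E.N (m + 1)) ^ στ * (Lc : ℝ) ^ 2 * (1 - Real.exp (-(4 * Real.pi ^ 2 * (E.kbar m * lo)))) ∧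
          Cη * ((E.N m : ℝ) / E.N (m + 1)) ^ ση ≤ 1 / 8 ∧
          ∀ S : Torus.Visc4 (Fin 3), Torus.OddSmall S β → Torus.NearIso S lo hi →
            Torus.OddSmall (Φ (E.cellVisc (m + 1)) S) β → Torus.NearIso (Φ (E.cellVisc (m + 1)) S) lo hi →
          ∀ (w₁ : VF) (hw₁ : IsDatum w₁), InClass R w₁ → Torus.fourierTruncate Lc w₁ = w₁ →
          ∀ Um Um1 : ℝ → ℝ → (V2 →L[ℝ] V2),
            Torus.IsPropagator 1 (E.partialSum m) (E.kbar m • renormStep (Φ (E.cellVisc (m + 1))) (E.gain / E.cellVisc (m + 1) ^ 2) S) Um →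
            Torus.IsPropagator 1 (E.partialSum (m + 1)) (E.kbar (m + 1) • S) Um1 →
          ∀ t ∈ Ioo (1/2 : ℝ) 1,
            ‖Um1 0 t (datumLp w₁ hw₁)‖ ^ 2
              ≤ ‖Um 0 t (datumLp w₁ hw₁)‖ ^ 2
                + Cη * ((E.N m : ℝ) / E.N (m + 1)) ^ ση * (‖datumLp w₁ hw₁‖ ^ 2 - ‖Um 0 t (datumLp w₁ hw₁)‖ ^ 2) := by
  intro k W M hM c hc Φ lo hi Λ β σ C ν₀ K Cf νf Kf hlo hlo1 hhi hΛ hβ hσ hC hν₀ hK hV hCf hνf hKf hF hH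
  obtain ⟨ν₁, hν₁, K₁, hK₁, Λ₀, θ₀, hθ₀, Cw, hCw, σw, hσw, hfacts⟩ :=
    hWF k W M hM c hc Φ lo hi Λ β σ C ν₀ K Cf νf Kf hlo hlo1 hhi hΛ hβ hσ hC hν₀ hK hV hCf hνf hKf hF hH
  refine ⟨ν₁, hν₁, K₁, hK₁, Λ₀, θ₀, hθ₀, 1800 * Cw + 6250, by positivity, σw, hσw, 1, one_pos, 1 / 16, by norm_num, ?_⟩
  intro E hdes hgain hnu0 hKE hLP hReg hT1 hN2 hT2 hT3 hT4 hT5 R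
  have hP : E.toFractalCarrierData.Permissible := hLP.1
  -- three eventual requirements on `m`
  obtain ⟨m₁, hm₁⟩ := trimLevel_export E hdes hc hgain hLP hθ₀ hT4 hT5 hT3 hN2 hlo (R : ℝ)
  obtain ⟨m₂, hm₂⟩ := hfacts E hdes hgain hnu0 hKE hLP hReg hT1 hN2 hT2 hT3 hT4 hT5
  obtain ⟨m₃, hm₃⟩ := exists_forall_mul_rho_rpow_le E.toFractalCarrierData hP hN2 (1800 * Cw + 6250) hσw (by norm_num : (0:ℝ) < 1 / 8)
  refine ⟨max m₁ (max m₂ m₃), fun m hm => ?_⟩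
  have hm1 : m₁ ≤ m := le_trans (le_max_left _ _) hm
  have hm2 : m₂ ≤ m := le_trans ((le_max_left _ _).trans (le_max_right _ _)) hm
  have hm3 : m₃ ≤ m := le_trans ((le_max_right _ _).trans (le_max_right _ _)) hm
  obtain ⟨Lc₀, hLc₀, hexport₀⟩ := hm₁ m hm1
  have hsmall : (1800 * Cw + 6250) * ((E.N m : ℝ) / E.N (m + 1)) ^ σw ≤ 1 / 8 := hm₃ m hm3
  obtain ⟨hr4, hfm⟩ := hm₂ m hm2
  set Lc : ℕ := ⌊((E.N m : ℝ) / E.N (m + 1)) ^ (1 / 64 : ℝ) * (E.N (m + 1) * E.cellVisc (m + 1)) / Real.sqrt c⌋₊ with hLc_def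
  have hLc₀Lc : Lc₀ ≤ Lc := Nat.le_floor hLc₀
  have hexport : (R : ℝ) ≤ 1 * ((E.N m : ℝ) / E.N (m + 1)) ^ (1 / 16 : ℝ) * (Lc : ℝ) ^ 2
      * (1 - Real.exp (-(4 * Real.pi ^ 2 * (E.kbar m * lo)))) := by
    have hρ0' : 0 ≤ ((E.N m : ℝ) / E.N (m + 1)) ^ (1 / 16 : ℝ) := Real.rpow_nonneg (by positivity) _
    have hfl0' : 0 ≤ 1 - Real.exp (-(4 * Real.pi ^ 2 * (E.kbar m * lo))) := by
      rw [sub_nonneg, Real.exp_le_one_iff]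
      have : 0 < 4 * Real.pi ^ 2 * (E.kbar m * lo) := by have := mul_pos (E.kbar_pos m) hlo; positivity
      linarith
    have hsq : (Lc₀ : ℝ) ^ 2 ≤ (Lc : ℝ) ^ 2 := by
      have : (Lc₀ : ℝ) ≤ Lc := by exact_mod_cast hLc₀Lc
      exact pow_le_pow_left₀ (Nat.cast_nonneg _) this 2
    calc (R : ℝ) ≤ _ := hexport₀
      _ ≤ ((E.N m : ℝ) / E.N (m + 1)) ^ (1 / 16 : ℝ) * (Lc : ℝ) ^ 2 * (1 - Real.exp (-(4 * Real.pi ^ 2 * (E.kbar m * lo)))) :=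
          mul_le_mul_of_nonneg_right (mul_le_mul_of_nonneg_left hsq hρ0') hfl0'
      _ = _ := by ring
  refine ⟨Lc, hexport, hsmall, ?_⟩
  intro S hS₁ hS₂ hS₃ hS₄ w₁ hw₁ _hRw hband Um Um1 hUm hUm1 t ht
  set ρ : ℝ := (E.N m : ℝ) / E.N (m + 1) with hρ_def
  set r : ℝ := E.refresh (m + 1) with hr_def
  set fl : ℝ := 1 - Real.exp (-(4 * Real.pi ^ 2 * (E.kbar m * lo))) with hfl_def
  set ηm : ℝ := Cw * ρ ^ σw with hηm_def
  set ε : ℝ := ρ ^ σw * fl * r with hε_def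
  set x : V2 := datumLp w₁ hw₁ with hx_def
  have hρ0 : 0 ≤ ρ := by rw [hρ_def]; have := E.N_pos m; have := E.N_pos (m + 1); positivity
  have hρσ : 0 ≤ ρ ^ σw := Real.rpow_nonneg hρ0 _
  have hr : 0 < r := E.refresh_pos (m + 1)
  have hkl : 0 < E.kbar m * lo := mul_pos (E.kbar_pos m) hlo
  have hfl0 : 0 ≤ fl := by
    rw [hfl_def, sub_nonneg, Real.exp_le_one_iff]; have : 0 < 4 * Real.pi ^ 2 * (E.kbar m * lo) := by positivity
    linarith
  have hfl1 : fl ≤ 1 := by rw [hfl_def]; linarith [Real.exp_pos (-(4 * Real.pi ^ 2 * (E.kbar m * lo)))]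
  have hηm0 : 0 ≤ ηm := by rw [hηm_def]; positivity
  have hηm : ηm ≤ 1 / 3600 := by rw [hηm_def]; nlinarith
  have hρσ1 : ρ ^ σw ≤ 1 / 6250 := by nlinarith
  have hε0 : 0 ≤ ε := by rw [hε_def]; positivity
  have hε1 : ε ≤ 1 := by
    rw [hε_def]
    calc ρ ^ σw * fl * r ≤ 1 / 6250 * 1 * (1 / 4) := by
          apply mul_le_mul (mul_le_mul hρσ1 hfl1 hfl0 (by norm_num)) hr4 hr.le (by norm_num)
      _ ≤ 1 := by norm_num
  obtain ⟨P, Q₁, Q₂, hPQ, hpyth, horth, hfw⟩ := hfm Lc hLc_def S hS₁ hS₂ hS₃ hS₄ Um Um1 hUm hUm1 ηm ε rfl rfl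
  obtain ⟨hQx, hwin⟩ := hfw w₁ hw₁ hband
  -- the transfer ledger along the grid of `t`
  have hx_div : Torus.IsWeaklyDivFree ((x : V2) : VF) := isWeaklyDivFree_datumLp w₁ hw₁
  have key := grid_transfer Um Um1 P Q₁ Q₂ x hr (by linarith [ht.1]) ht.2.le
    hUm.norm_le hUm1.norm_le
    (fun s s' s'' y hs hss' hs's'' hs''1 => hUm.comp s s' s'' hs hss' hs's'' hs''1 y)
    (fun s s' s'' y hs hss' hs's'' hs''1 => hUm1.comp s s' s'' hs hss' hs's'' hs''1 y)
    (hUm.self_of_divFree 0 le_rfl zero_le_one x hx_div) (hUm1.self_of_divFree 0 le_rfl zero_le_one x hx_div)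
    hPQ hpyth horth hQx hηm0 hηm hε0 hε1
    (fun j s' h1 h2 h3 => hwin j s' h1 h2 (h3.trans ht.2.le))
  -- the coarse drop floor
  have hgain0 : 0 ≤ E.gain := hgain ▸ hc.le
  have h𝔸v : Torus.NearIso (E.kbar m • renormStep (Φ (E.cellVisc (m + 1))) (E.gain / E.cellVisc (m + 1) ^ 2) S)
      (E.kbar m * lo) (E.kbar m * hi) :=
    (nearIso_renormStep (div_nonneg hgain0 (sq_nonneg _)) hS₂ hS₄).smul (E.kbar_pos m).le
  have hfloor : fl * ‖x‖ ^ 2 ≤ ‖x‖ ^ 2 - ‖Um 0 t x‖ ^ 2 := coarse_drop_floor E hLP hReg m hkl h𝔸v hUm w₁ hw₁ ht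
  have hx0 : 0 ≤ ‖x‖ ^ 2 := sq_nonneg _
  have hdrop0 : 0 ≤ ‖x‖ ^ 2 - ‖Um 0 t x‖ ^ 2 := le_trans (mul_nonneg hfl0 hx0) hfloor
  have ht1 : t ≤ 1 := ht.2.le
  have hjunk : 5000 * (t / r + 1) * ε * ‖x‖ ^ 2 ≤ 6250 * ρ ^ σw * (‖x‖ ^ 2 - ‖Um 0 t x‖ ^ 2) := by
    have e1 : (t / r + 1) * ε = ρ ^ σw * fl * (t + r) := by
      rw [hε_def]; field_simp
    have h2 : 5000 * (t / r + 1) * ε * ‖x‖ ^ 2 = 5000 * (ρ ^ σw * (t + r)) * (fl * ‖x‖ ^ 2) := by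
      rw [show 5000 * (t / r + 1) * ε * ‖x‖ ^ 2 = 5000 * ((t / r + 1) * ε) * ‖x‖ ^ 2 by ring, e1]; ring
    rw [h2]
    have h3 : t + r ≤ 5 / 4 := by linarith
    have h4 : 5000 * (ρ ^ σw * (t + r)) ≤ 6250 * ρ ^ σw := by nlinarith
    calc 5000 * (ρ ^ σw * (t + r)) * (fl * ‖x‖ ^ 2) ≤ 6250 * ρ ^ σw * (fl * ‖x‖ ^ 2) :=
          mul_le_mul_of_nonneg_right h4 (mul_nonneg hfl0 hx0)
      _ ≤ 6250 * ρ ^ σw * (‖x‖ ^ 2 - ‖Um 0 t x‖ ^ 2) := mul_le_mul_of_nonneg_left hfloor (by positivity)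
  have hmain : 1800 * ηm * (‖x‖ ^ 2 - ‖Um 0 t x‖ ^ 2) + 6250 * ρ ^ σw * (‖x‖ ^ 2 - ‖Um 0 t x‖ ^ 2)
      = (1800 * Cw + 6250) * ρ ^ σw * (‖x‖ ^ 2 - ‖Um 0 t x‖ ^ 2) := by rw [hηm_def]; ring
  linarith [key, hjunk, hmain]

end Summit.AnomalousDissipation.AnomalousDissipation.Theorems.SolenoidalFractalHomogenisation.LagrangianStep

end
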